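import Summits.Ventures.PercRepro.SixFourT4Generic
import Summits.Ventures.PercRepro.SixFourT4Large

/-!
# C-025, the `(6,4)` case: Theorem 22 as a conditional statement (mine-2's §22)

This file assembles the three regimes of Theorem 22 — `0 ≤ J₄(G)` for every rank-`4` set `G ⊆ E` of a simple
matroid with at least `10` points and every plane trace of at most `7` points:

* `15 ≤ g`: `J_four_pos_of_fifteen_le` (§22.7, in the kernel);
* `10 ≤ g ≤ 14` and `G` generic (no plane trace of rank `≤ 2` carrying a line through two points of `G` outside it, see
  `Generic`): `J_four_nonneg_of_generic` (§22.5, in the kernel);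
* `10 ≤ g ≤ 14` and `G` not generic (the *plane-line* case): mine-2's §22.6, a finite enumeration for `g = 10..13`
  together with the non-existence of such configurations at `g = 14`. This step is NOT in the kernel yet; it is
  recorded here as the explicit hypothesis `SixTwoSix`, and Theorem 22 is proved conditionally on it.

Nothing in this file is an axiom: `SixTwoSix` is an ordinary `Prop`, and `J_four_nonneg_of_sixTwoSix` takes it as a
hypothesis. Discharging `SixTwoSix` turns the conditional theorem into Theorem 22 itself.
-/

namespace PercRepro.SixFour

open Finset ThmH

universe u

variable {α : Type u} [DecidableEq α] {M : Matroid α} [M.Finite] {G : Finset α}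

/-- **§22.6 (the plane-line case of Theorem 22, as a hypothesis)**: for every simple matroid `M` on a type in universe
`u` and every NON-generic rank-`4` set `G ⊆ E` with `10 ≤ g ≤ 14` points and plane traces of at most `7` points,
`0 < J₄(G)`. Mine-2's §22.6 establishes this by a finite enumeration (`g = 10..13`) and the non-existence of plane-line
configurations at `g = 14`; it is not yet a kernel theorem. -/
def SixTwoSix : Prop :=
  ∀ {β : Type u} [DecidableEq β] (M : Matroid β) [M.Finite] (G : Finset β), Simple M → G ⊆ gr M →
    M.eRk (G : Set β) = 4 → ¬ Generic M G → (∀ P ∈ planes M, (P ∩ G).card ≤ 7) → 10 ≤ G.card →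
    G.card ≤ 14 → 0 < J M G 4

/-- **Theorem 22, conditional on §22.6**: if `SixTwoSix` holds, then for every simple matroid `M` and every rank-`4`
set `G ⊆ E` with at least `10` points and plane traces of at most `7` points, `0 ≤ J₄(G)`. The case `g ≥ 15` is
`J_four_pos_of_fifteen_le`, the generic case with `g ≤ 14` is `J_four_nonneg_of_generic`, and the plane-line case with
`g ≤ 14` is the hypothesis. -/
theorem J_four_nonneg_of_sixTwoSix (h : SixTwoSix.{u}) (hs : Simple M) (hG : G ⊆ gr M) (hr : M.eRk (G : Set α) = 4)
    (hpl : ∀ P ∈ planes M, (P ∩ G).card ≤ 7) (hg : 10 ≤ G.card) : 0 ≤ J M G 4 := by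
  by_cases h15 : 15 ≤ G.card
  · exact (J_four_pos_of_fifteen_le hs hG hr hpl h15).le
  · have hg' : G.card ≤ 14 := by omega
    by_cases hgen : Generic M G
    · exact J_four_nonneg_of_generic hs hG hr hgen hpl hg hg'
    · exact (h M G hs hG hr hgen hpl hg hg').le

/-- **Theorem 22, conditional on §22.6, strict form for `g ≥ 15` or plane-line `G`**: under `SixTwoSix`, `J₄(G) > 0`
unless `10 ≤ g ≤ 14` and `G` is generic (where `J_four_nonneg_of_generic` gives `0 ≤ J₄(G)`). -/
theorem J_four_pos_of_sixTwoSix (h : SixTwoSix.{u}) (hs : Simple M) (hG : G ⊆ gr M) (hr : M.eRk (G : Set α) = 4)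
    (hpl : ∀ P ∈ planes M, (P ∩ G).card ≤ 7) (hg : 10 ≤ G.card) (hng : 15 ≤ G.card ∨ ¬ Generic M G) :
    0 < J M G 4 := by
  rcases hng with h15 | hgen
  · exact J_four_pos_of_fifteen_le hs hG hr hpl h15
  · by_cases h15 : 15 ≤ G.card
    · exact J_four_pos_of_fifteen_le hs hG hr hpl h15
    · exact h M G hs hG hr hgen hpl hg (by omega)

end PercRepro.SixFour
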